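import Summits.BirchSwinnertonDyer.BirchSwinnertonDyer.Theorems.ClassRecordThreeEulerHalvesAtThreeCartanCoverDockedLineSaturation
import Summits.BirchSwinnertonDyer.BirchSwinnertonDyer.Theorems.ClassRecordThreeEulerHalvesAtThreeCartanCarayolRamified
import HarnessLib

/-!
# Crux NUM `CartanOnePlaceDegreeLawAtThree` (stmt-BirchSwinnertonDyer-24801) ∕ `EulerHalvesAtThree` (19109) — THE CARAYOL CUT of the Galois leaf, Theorems level
# STAGED by ideator `bsd-idea-10` g18 (2026-08-29): to be proposed (definition lane, `--supports stmt-BirchSwinnertonDyer-19109`) AS SOON AS the LEAD's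
# `Theorems/…CartanCoverDockedLineSaturation.lean` (ns `…Theorems.CartanCover.Charext`, Props (M0) ∕ (OBS), `saturationAtThree_of_leaves`) is in the tree.
# Statements BYTE-IDENTICAL to `Cruxes/EulerHalvesAtThree/Lines/cartan_carayol.lean` (commit ae884a356928) §1–§3.

(OBS) `CartanCover.Charext.NoModThreePeriodCharacterExtension` — the ONE Galois statement modulo which `Lines/lattice` v6 closes NUM — is the conjunction of
* (CAR) `CartanCarayol.CarayolUnramifiedAtThree` [print content, DEFINED here, nothing asserted]: an extension mod `3Λ` of the scaled period character `c·per_F`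
  from `Γ̄(q)` to the level-prime-to-`q` group `ι(O₀'¹)`, with `c·per_F ≢ 0 (mod 3Λ)` on `Γ̄(q)`, forces `V[3]` UNRAMIFIED at `q` — the output shape of level
  optimisation on Shimura curves (res-injectivity `Hom(SL₂(𝔽_q), 𝔽₃) = 0` [PROVED by cruxidea-24801-1, `Lines/charext` v8.1 §InertHecke
  `modThree_trivial_of_trivial_on_principalLevel`]; Hecke compatibility of restriction; Deligne–Serre 6.11 + Eichler–Shimura + Jacquet–Langlands on `X_{O₀'}`
  (level prime to `q`) + «conductor = level»), and
* (RAM) `CartanCarayol.not_threeTorsion_unramified_of_mem_cartanPlaces` [TREE, p736694]: a Cartan place `q ≠ 3` is additive, so `V[3]` is RAMIFIED at `q`.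
PROVED here: `noModThreePeriodCharacterExtension_of_carayol : CAR → OBS` (by_contra, five lines) and the re-hung (D4)
`saturationAtThree_of_carayol : (M) → (M0) → CAR → CartanCover.SaturationAtThree` (via the LEAD's `CartanCover.Charext.saturationAtThree_of_leaves`).
HONEST: one `Prop` definition (CAR, asserted nowhere) and two implications; nothing is proved about any curve's `L`-value; 24801 ∕ 23422 ∕ 19109 open;
no summit statement is proved; BSD is proved for no curve.
[cite: Carayol1989, Thm. (A)] [cite: Carayol1986, Thm. (A)] [cite: DeligneSerre1974, Lemme 6.11] [cite: DiamondTaylor1994, Thm. 1 and §1] [cite: Edixhoven1997, §4.4]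
[cite: KohenPacetti2016, Rem. 3.8 (arXiv:1403.7801v3 p. 15)] [cite: Silverman2009, VII.6.1]
-/

set_option linter.dupNamespace false
set_option autoImplicit false

noncomputable section

open scoped Classical MatrixGroups UpperHalfPlane NumberField

namespace Summit.BirchSwinnertonDyer.BirchSwinnertonDyer.Theorems.CartanCarayol

open Summit.BirchSwinnertonDyer.BirchSwinnertonDyer.Theorems
open Literature.NumberTheory.Automorphic WeierstrassCurve Literature.NumberTheory.EllipticCurves
  Literature.NumberTheory.EllipticCurves.Rank1Residual Summit.BirchSwinnertonDyer.Rank1Residual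
open NumberField IsDedekindDomain

/-- **(CAR) CARAYOL'S OBSTRUCTION AT A CARTAN PLACE, mod 3** [PRINT CONTENT; nothing asserted]. For `V/ℚ` with `ρ̄_{V,3}` surjective, a Cartan datum
`X` of level `(D, M; C)` with `N(V) = D·M·∏_{p∈C} p²`, a Cartan place `q ∈ C`, `q ≠ 3`, and class-minimal parametrisation data `Q` of `W₁ ~ V` on `X`:
IF a `Λ(W₁)`-valued function `χ` on `GL₂(ℝ)` is a homomorphism mod `3Λ` on `ι(O₀'¹) = coverUnits X q` and agrees mod `3Λ` with `c·per_F` (`F = Q.form`)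
on `Γ̄(q) = principalLevel X q`, AND `c·per_F ≢ 0 (mod 3Λ)` on `Γ̄(q)`, THEN `V[3]` is unramified at `q` (inertia at every place of `𝓞 ℚ` over `q` fixes
`V[3](ℚ̄)` pointwise). Route: res-injectivity (`Hom(SL₂(𝔽_q), 𝔽₃) = 0`, (M0)) ⇒ unique hence Hecke-eigen extension (`a_ℓ(V) mod 3`, `Q.hecke_eq`,
`Q.IsMinimalFor`); Deligne–Serre + Eichler–Shimura + Jacquet–Langlands on `X_{O₀'}` (level prime to `q`) + «conductor = level». Why it might fail: not as
mathematics; TYPING debt (Hecke operators on `Hom(coverUnits X q, Λ∕3Λ)`, Galois representations for mod-3 eigen-systems on Cartan-level quaternionic groups).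
Its hypotheses are never met by an actual `V` (RAM): an OBSTRUCTION statement. [cite: Carayol1989, Thm. (A)] [cite: DeligneSerre1974, Lemme 6.11] [cite: DiamondTaylor1994, Thm. 1 and §1] -/
@[conjecture]
def CarayolUnramifiedAtThree : Prop :=
  ∀ (V : WeierstrassCurve ℚ) [V.IsElliptic], Surj V 3 →
    ∀ (N D M : ℕ) (C : Finset ℕ) (q : ℕ) [Fact q.Prime]
      (X : CartanLevelCurveData D M C) (W₁ : WeierstrassCurve ℚ) [W₁.IsElliptic] (Q : CartanParametrizationData X W₁),
      q ∈ C → V.conductorNorm ℤ = N → D * M * ∏ p ∈ C, p ^ 2 = N → q ≠ 3 → Q.IsMinimalFor V →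
      ∀ (c : ℂ) (χ : GL (Fin 2) ℝ → ℂ),
        (∀ γ ∈ CartanCover.coverUnits X q, χ γ ∈ Q.L.lattice) →
        (∀ γ ∈ CartanCover.coverUnits X q, ∀ δ ∈ CartanCover.coverUnits X q,
          ∃ y ∈ Q.L.lattice, χ (γ * δ) - χ γ - χ δ = 3 * y) →
        (∀ β ∈ CartanCover.principalLevel X q,
          ∃ y ∈ Q.L.lattice, χ β - c * segmentIntegral (⇑Q.form) Q.basePoint (β • Q.basePoint) = 3 * y) →
        (¬ ∀ β ∈ CartanCover.principalLevel X q,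
          ∃ y ∈ Q.L.lattice, c * segmentIntegral (⇑Q.form) Q.basePoint (β • Q.basePoint) = 3 * y) →
        ∀ v : HeightOneSpectrum (𝓞 ℚ), (q : 𝓞 ℚ) ∈ v.asIdeal →
          ∀ σ ∈ GreenbergSelmer.inertia v, ∀ P : geomTorsion V (3 : ℤ), σ • P = P

/-- **OBS from CAR** — `CartanCover.Charext.NoModThreePeriodCharacterExtension` BY NAME follows from Carayol's obstruction (CAR) and the tree theorem RAM
`not_threeTorsion_unramified_of_mem_cartanPlaces` (p736694): were `c·per_F ≢ 0 (mod 3Λ)` on `Γ̄(q)`, CAR would make `V[3]` unramified at `q`, which RAM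
refutes. [cite: Silverman2009, VII.6.1] [cite: Carayol1989, Thm. (A)] -/
theorem noModThreePeriodCharacterExtension_of_carayol (hCAR : CarayolUnramifiedAtThree) :
    CartanCover.Charext.NoModThreePeriodCharacterExtension := by
  intro V _ _ hX hS N D M C q _ X W₁ _ Q hq hN hDMC hq3 hq3N hc3 hmin hq1 c χ hχΛ hχadd hχres
  by_contra hne
  exact not_threeTorsion_unramified_of_mem_cartanPlaces V hq hN hDMC hq3
    (hCAR V hS N D M C q X W₁ Q hq hN hDMC hq3 hmin c χ hχΛ hχadd hχres hne)

/-- **(D4) `CartanCover.SaturationAtThree` from (M) + (M0) + CAR** — the LEAD's `CartanCover.Charext.saturationAtThree_of_leaves` with its Galois leaf (OBS)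
replaced by Carayol's obstruction (CAR); RAM is discharged from the tree. [cite: KohenPacetti2016, Rem. 3.8] [cite: Carayol1989, Thm. (A)] -/
theorem saturationAtThree_of_carayol (hM : CartanCover.PeriodLatticeCharacter) (hM0 : CartanCover.Charext.StrongApproxAtCartanPlace)
    (hCAR : CarayolUnramifiedAtThree) : CartanCover.SaturationAtThree :=
  CartanCover.Charext.saturationAtThree_of_leaves hM hM0 (noModThreePeriodCharacterExtension_of_carayol hCAR)

end Summit.BirchSwinnertonDyer.BirchSwinnertonDyer.Theorems.CartanCarayol

end
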